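import Summits.Ventures.DiscreteObjects.Hadamard.SignedMultiplierTMatrices668Final
import Summits.Ventures.DiscreteObjects.Hadamard.AffineSymmetryGSQuad668

/-!
# Hadamard 668 census — no affine signed/permuted symmetry of circulant T-matrices of order 167 (kernel)

Framing: lottery ticket; floor = certified bounds/negative ranges.

Cell pub-namedobj (venture DiscreteObjects), target (H), hadamard gen 25.  Parts I–III (`SignedMultiplierTMatrices668{,Census,
Final}`) exclude every LINEAR signed/permuted symmetry `t_{π k}(h x) = ε_k t_k(x)` (`h ≠ 0, 1`) of first rows of circulant
T-matrices of order `167`.  Here the whole affine group `x ↦ h x + c` of `ZMod 167` (`(h, c) ≠ (1, 0)`, `h ≠ 0`) is excluded,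
again with an arbitrary permutation `π ∈ S₄` of the four rows and arbitrary signs:
* `signedSymmetry_iterate` — for ANY map `φ` of the index set, `t_{π k}(φ x) = ε_k t_k(x)` iterates to
  `t_{πᵐ k}(φᵐ x) = E_m(k) t_k(x)`; with `π²⁴ = 1` twice, `t` is invariant under `φ⁴⁸`;
* **`no_signedTranslation_tMatrixRows_167`** — translations `x ↦ x + c`, `c ≠ 0`: invariance under `x ↦ x + 48c` makes every
  row constant (`48c` generates `ZMod 167`), so one row is a constant `±1` row with `PAF(s) = 167 ≠ 0` — impossible;
* **`no_signedAffine_tMatrixRows_167`** — `h ≠ 0, 1`: the affine map has the fixed point `x₀ = c (1 - h)⁻¹`, and translating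
  the rows by `x₀` (which preserves `IsTMatrixRows`) turns the symmetry into the linear one `x ↦ h x`, excluded by
  `no_signedMultiplier_tMatrixRows_167`;
* **`no_affineSymmetry_tMatrixRows_167`** — summary: for `h ≠ 0` and `(h, c) ≠ (1, 0)` there are no first rows of circulant
  T-matrices of order `167` with `t_{π k}(h x + c) = ε_k t_k(x)`.
So the T-matrix route to `H(668)` admits NO symmetry from `AGL(1, 167) × (signed S₄)` beyond the identity: every structured
sub-family of this kind is EMPTY; unstructured T-matrices of order 167 remain open.  NEGATIVE lines about a hypothetical
object; no Hadamard order excluded; H(668) untouched; HITS 0/4.  Ours, elementary; no `sorry`.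
-/

open Finset BigOperators

namespace Summit.Ventures.DiscreteObjects.Hadamard

open Literature.Combinatorics.Designs.LegendrePairs (PAF)
open Literature.Combinatorics.Designs.TSequences
open Literature.Combinatorics.Designs.TMatrices

/-! ## §17 Iterating a signed/permuted symmetry along an arbitrary map -/

section Iterate

variable {X : Type*} {t : Fin 4 → X → ℤ} {φ : X → X} {π : Equiv.Perm (Fin 4)} {ε : Fin 4 → ℤ}

/-- iterating `t (π k) (φ x) = ε_k t_k(x)`: `t (πᵐ k) (φ^[m] x) = E_m(k) t_k(x)` with signs `E_m`. -/
lemma signedSymmetry_iterate (hε : ∀ k, ε k = 1 ∨ ε k = -1) (hrel : ∀ k x, t (π k) (φ x) = ε k * t k x) :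
    ∀ m : ℕ, ∃ E : Fin 4 → ℤ, (∀ k, E k = 1 ∨ E k = -1) ∧ ∀ k x, t ((π ^ m) k) (φ^[m] x) = E k * t k x
  | 0 => ⟨fun _ => 1, fun _ => Or.inl rfl, fun k x => by simp⟩
  | m + 1 => by
      obtain ⟨E, hE, h⟩ := signedSymmetry_iterate hε hrel m
      refine ⟨fun k => ε ((π ^ m) k) * E k, fun k => ?_, fun k x => ?_⟩
      · rcases hε ((π ^ m) k) with e | e <;> rcases hE k with e' | e' <;> simp [e, e']
      · rw [pow_succ', Equiv.Perm.mul_apply, Function.iterate_succ_apply', hrel, h, mul_assoc]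

/-- **invariance under `φ⁴⁸`** (the signs square away since `π²⁴ = 1`). -/
theorem invariant_iterate48_of_signedSymmetry (hε : ∀ k, ε k = 1 ∨ ε k = -1)
    (hrel : ∀ k x, t (π k) (φ x) = ε k * t k x) : ∀ k x, t k (φ^[48] x) = t k x := by
  obtain ⟨E, hE, h24⟩ := signedSymmetry_iterate hε hrel 24
  rw [perm_fin4_pow_24] at h24
  intro k x
  have e1 := h24 k (φ^[24] x)
  have e2 := h24 k x
  simp only [Equiv.Perm.coe_one, id_eq] at e1 e2
  rw [show φ^[48] x = φ^[24] (φ^[24] x) by rw [← Function.iterate_add_apply], e1, e2, ← mul_assoc]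
  rcases hE k with e | e <;> simp [e]

end Iterate

/-! ## §18 Translations -/

/-- iterating the translation `x ↦ x + c`: `(· + c)^[m] x = x + m • c`. -/
lemma iterate_add_const {n : ℕ} (c x : ZMod n) (m : ℕ) : (fun y => y + c)^[m] x = x + (m : ZMod n) * c := by
  induction m with
  | zero => simp
  | succ m ih => rw [Function.iterate_succ_apply', ih]; push_cast; ring

/-- **no translation symmetry**: first rows of circulant T-matrices of order `167` cannot satisfy
`t_{π k}(x + c) = ε_k t_k(x)` with `c ≠ 0` (every row would be constant). -/
theorem no_signedTranslation_tMatrixRows_167 {c : ZMod 167} (hc : c ≠ 0) :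
    ¬ ∃ (t : Fin 4 → ZMod 167 → ℤ) (π : Equiv.Perm (Fin 4)) (ε : Fin 4 → ℤ),
      IsTMatrixRows 167 t ∧ (∀ k, ε k = 1 ∨ ε k = -1) ∧ ∀ k x, t (π k) (x + c) = ε k * t k x := by
  rintro ⟨t, π, ε, ht, hε, hrel⟩
  haveI : Fact (Nat.Prime 167) := ⟨by norm_num⟩
  have hinv := invariant_iterate48_of_signedSymmetry (φ := fun y => y + c) hε hrel
  have hd : (48 : ZMod 167) * c ≠ 0 := mul_ne_zero fortyEight_ne_zero_zmod167 hc
  have hconst : ∀ k x, t k x = t k 0 := fun k x =>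
    const_of_translationInvariant_167 hd (fun y => by
      have e := hinv k y
      rw [iterate_add_const] at e
      exact_mod_cast e) x
  -- the row through `0` is then a constant `±1` row: its autocorrelation at shift `1` is `167`, not `0`
  obtain ⟨k₀, hk₀, hz⟩ := ht.1 0
  have hothers : ∀ k, k ≠ k₀ → ∀ x, t k x = 0 := fun k hk x => by rw [hconst k x]; exact hz k hk
  have h1 : (1 : ZMod 167) ≠ 0 := one_ne_zero
  have hsum := ht.2 1 h1
  rw [← Finset.add_sum_erase _ _ (mem_univ k₀)] at hsum
  have hrest : ∑ k ∈ univ.erase k₀, PAF (t k) 1 = 0 :=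
    Finset.sum_eq_zero fun k hk => by
      unfold PAF
      exact Finset.sum_eq_zero fun x _ => by rw [hothers k (Finset.ne_of_mem_erase hk) x, zero_mul]
  have hP0 : PAF (t k₀) 1 = 167 := by
    unfold PAF
    rw [Finset.sum_congr rfl fun x _ => by rw [hconst k₀ x, hconst k₀ (x + 1)]]
    rw [Finset.sum_const, Finset.card_univ, ZMod.card]
    rcases hk₀ with e | e <;> rw [e] <;> norm_num
  rw [hrest, hP0] at hsum
  norm_num at hsum

/-! ## §19 Affine maps with `h ≠ 1`: reduce to the linear census -/

/-- **no affine signed/permuted symmetry with `h ≠ 0, 1`**: `t_{π k}(h x + c) = ε_k t_k(x)` is impossible for first rows of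
circulant T-matrices of order `167` — translate by the fixed point `x₀ = c (1 - h)⁻¹` and apply part III. -/
theorem no_signedAffine_tMatrixRows_167 {h c : ZMod 167} (h0 : h ≠ 0) (h1 : h ≠ 1) :
    ¬ ∃ (t : Fin 4 → ZMod 167 → ℤ) (π : Equiv.Perm (Fin 4)) (ε : Fin 4 → ℤ),
      IsTMatrixRows 167 t ∧ (∀ k, ε k = 1 ∨ ε k = -1) ∧ ∀ k x, t (π k) (h * x + c) = ε k * t k x := by
  rintro ⟨t, π, ε, ht, hε, hrel⟩
  haveI : Fact (Nat.Prime 167) := ⟨by norm_num⟩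
  -- the fixed point
  have h1' : (1 - h : ZMod 167) ≠ 0 := sub_ne_zero.mpr (Ne.symm h1)
  set x₀ : ZMod 167 := c * (1 - h)⁻¹ with hx₀
  have hfix : h * x₀ + c = x₀ := by
    have e : x₀ * (1 - h) = c := by rw [hx₀, mul_assoc, inv_mul_cancel₀ h1', mul_one]
    have e' : x₀ - h * x₀ = c := by rw [← e]; ring
    rw [← e']; ring
  -- translated rows carry the LINEAR symmetry
  set u : Fin 4 → ZMod 167 → ℤ := fun k x => t k (x + x₀) with hu
  have hut : IsTMatrixRows 167 u := tmatrixRows_translate ht x₀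
  have hlin : ∀ k x, u (π k) (h * x) = ε k * u k x := fun k x => by
    simp only [hu]
    have e : h * x + x₀ = h * (x + x₀) + c := by
      conv_lhs => rw [← hfix]
      ring
    rw [e]
    exact hrel k (x + x₀)
  exact no_signedMultiplier_tMatrixRows_167 h0 h1 ⟨u, π, ε, hut, hε, hlin⟩

/-- **summary: no symmetry from `AGL(1, 167) × (signed S₄)`.**  For `h ≠ 0` and `(h, c) ≠ (1, 0)` there are no first rows of
circulant T-matrices of order `167` with `t_{π k}(h x + c) = ε_k t_k(x)` (`π ∈ S₄`, `ε_k = ±1`).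
lottery ticket; floor = certified bounds/negative ranges. -/
theorem no_affineSymmetry_tMatrixRows_167 {h c : ZMod 167} (h0 : h ≠ 0) (hne : ¬ (h = 1 ∧ c = 0)) :
    ¬ ∃ (t : Fin 4 → ZMod 167 → ℤ) (π : Equiv.Perm (Fin 4)) (ε : Fin 4 → ℤ),
      IsTMatrixRows 167 t ∧ (∀ k, ε k = 1 ∨ ε k = -1) ∧ ∀ k x, t (π k) (h * x + c) = ε k * t k x := by
  by_cases h1 : h = 1
  · subst h1
    have hc : c ≠ 0 := fun e => hne ⟨rfl, e⟩
    rintro ⟨t, π, ε, ht, hε, hrel⟩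
    exact no_signedTranslation_tMatrixRows_167 hc ⟨t, π, ε, ht, hε, fun k x => by rw [← hrel k x, one_mul]⟩
  · exact no_signedAffine_tMatrixRows_167 h0 h1

end Summit.Ventures.DiscreteObjects.Hadamard
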